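import Summits.ValiantsHypothesis.ValiantsHypothesis.Theorems.DualUnipotentThreeHalves.Negative.ThinWildFamily

/-!
# `¬ ThinWild`: irreducible spaces of nilpotent matrices with large dimension AND large nil-index

Negative lane of crux `GrenetZeon.DualUnipotentThreeHalves` (item `stmt-ValiantsHypothesis-24318`; this file closes
nothing and proves nothing about the `3/2` rung, `per_n`, or VP ≠ VNP).  It records, kernel-checked, the counterexample that
killed the line `thin_wild` (skeleton `Cruxes/DualUnipotentThreeHalves/Lines/thin_wild.lean`, stubs T2 `ThinWild` / T2♭
`ThinWildFat`; census `Lines/thin_wild_dead.md`), using the family `L′_k ⊂ M_{3k}(ℂ)` of `ThinWildFamily.lean`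
(nilpotent, irreducible, `dim ≥ k²`, an element with `N^{2k} ≠ 0`, all `N^{2k+1} = 0`).  This file is
definition-free (negative lemmas only).

## Contents
* `level_const_of_irreducible` — BRIDGE (any finite index type): if ONE conjugation `M ↦ P·M·Q` (`P·Q = 1`) makes an
  irreducible space block-upper-triangular for a level function, the level function is constant (the `Q`-image of the
  coordinate subspace of the minimal level is a non-zero invariant subspace);
* `reindexSpace_*`, `exists_Lfin` — transport of the five facts to a `Fin (3k)`-indexed copy of `L′_k`;
* `exists_irreducible_nilpotent_space_pow_ne_zero` — for every `r` an irreducible space of nilpotent matrices of dimension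
  `≥ (r+1)²` with an element of nil-index `> r` (contrast: the MOR 1991 §5 examples have index `3`; `span{S, R}` has index
  `d` but dimension `2`);
* `thinWild_false : ¬ (body of ThinWild)` and `thinWildFat_false : ¬ (body of ThinWildFat)` — the bodies are inlined
  VERBATIM from the skeleton (tree sha16 `257da148ab0aab37`; `Iff.rfl` against the skeleton's `def`s checked in scratch,
  since `Cruxes/…/Lines/*.lean` modules are not importable here); witnesses `k = 5C+1` resp. `k = 5C+9`, `d = 3k`,
  `r = 2k`: `dim·r ≥ 2k³ > 9C·k² = C·d²` (and `d⁴ = 81k⁴ ≤ k⁶ ≤ dim³` in the fat version);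
* `no_cheap_indexMass_by_conjugation` — portrait of stub U2 `WildUnfold.CheapIndexMass` of the live line `wild_portrait` at
  the level of matrix spaces: for every `C` an irreducible nilpotent space `L ⊂ M_d(ℂ)` ALL of whose conjugate block forms
  (block-upper for `lev`, level-`l` diagonal block of nil-index `≤ r l`) have index mass `Σ_u r(lev u) > C·d`.  So the
  `≤ C·m` index mass that U2 asks of SOME affine representation of `per_n` is not obtainable from a given representation by
  a change of basis alone: re-representation (or the permanent itself) is load-bearing for U2.  (U2 is not refuted: it
  quantifies over new representations `(N, M)` of `per_n`; cf. `CheapIndexMassViaWidthSaving.lean`.)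

Classification: negative lemmas (`--supports stmt-ValiantsHypothesis-24318`); no Theses declaration is asserted or negated
(T2/T2♭ are skeleton-local stubs of a line already marked dead by its critic; this is their Lean record, «P2» of the critic's
verdict).  Literature context (titles/abstracts searched; not a novelty claim): Mathes–Omladič–Radjavi, LAA 149 (1991)
215–225 §5; Radjavi–Rosenthal, *Simultaneous Triangularization* (Universitext, 2000); Mastnak–Omladič–Radjavi, LAA 611
(2021) 260–278.
-/

set_option linter.dupNamespace false
set_option autoImplicit false

namespace Summit.ValiantsHypothesis.ValiantsHypothesis.Theorems.DualUnipotentThreeHalvesNegative.ThinWild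

open Matrix

/-! ## One conjugation cannot grade an irreducible space: conjugate block forms have a single level -/

section Bridge

variable {n : Type} [Fintype n] [DecidableEq n]

/-- **Bridge lemma.** If `L` acts irreducibly and ONE conjugation `M ↦ P·M·Q` (`P·Q = 1`) puts every member of `L` in
block-upper-triangular form for the level function `lev`, then `lev` is constant: the `Q`-image of the coordinate
subspace of the minimal level is a non-zero invariant subspace. -/
theorem level_const_of_irreducible (L : Submodule ℂ (Matrix n n ℂ))
    (hirr : ∀ W : Submodule ℂ (n → ℂ), (∀ M ∈ L, ∀ x ∈ W, M *ᵥ x ∈ W) → W = ⊥ ∨ W = ⊤)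
    (P Q : Matrix n n ℂ) (hPQ : P * Q = 1) (lev : n → ℕ)
    (hup : ∀ M ∈ L, ∀ i j, lev j < lev i → (P * M * Q) i j = 0) (u u' : n) : lev u = lev u' := by
  by_contra hne
  have hQP : Q * P = 1 := mul_eq_one_comm.mp hPQ
  obtain ⟨u₀, -, hu₀⟩ := Finset.exists_min_image Finset.univ lev ⟨u, Finset.mem_univ u⟩
  -- vectors supported on the minimal level
  let W₀ : Submodule ℂ (n → ℂ) :=
    { carrier := {x | ∀ i, lev i ≠ lev u₀ → x i = 0}
      zero_mem' := fun _ _ => rfl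
      add_mem' := fun {x y} hx hy i hi => by simp [hx i hi, hy i hi]
      smul_mem' := fun a {x} hx i hi => by simp [hx i hi] }
  have hW₀ : ∀ x : n → ℂ, x ∈ W₀ ↔ ∀ i, lev i ≠ lev u₀ → x i = 0 := fun x => Iff.rfl
  let W : Submodule ℂ (n → ℂ) := W₀.map (Matrix.mulVecLin Q)
  have hWinv : ∀ M ∈ L, ∀ x ∈ W, M *ᵥ x ∈ W := by
    intro M hM x hx
    obtain ⟨y, hy, rfl⟩ := Submodule.mem_map.mp hx
    have hy' := (hW₀ y).1 hy
    refine Submodule.mem_map.mpr ⟨(P * M * Q) *ᵥ y, (hW₀ _).2 ?_, ?_⟩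
    · intro i hi
      have hlt : lev u₀ < lev i := lt_of_le_of_ne (hu₀ i (Finset.mem_univ i)) (Ne.symm hi)
      simp only [Matrix.mulVec, dotProduct]
      apply Finset.sum_eq_zero
      intro j _
      by_cases hj : lev j = lev u₀
      · rw [hup M hM i j (hj ▸ hlt), zero_mul]
      · rw [hy' j hj, mul_zero]
    · simp only [Matrix.mulVecLin_apply, Matrix.mulVec_mulVec]
      rw [← Matrix.mul_assoc, ← Matrix.mul_assoc, hQP, Matrix.one_mul]
  have hWbot : W ≠ ⊥ := by
    intro hbot
    have hmem : Q *ᵥ Pi.single u₀ 1 ∈ W := by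
      refine Submodule.mem_map.mpr ⟨Pi.single u₀ 1, (hW₀ _).2 ?_, rfl⟩
      intro i hi
      have : i ≠ u₀ := fun h => hi (by rw [h])
      simp [this]
    rw [hbot, Submodule.mem_bot] at hmem
    have h1 := congr_arg (fun v => P *ᵥ v) hmem
    simp only [Matrix.mulVec_mulVec, hPQ, Matrix.one_mulVec, Matrix.mulVec_zero] at h1
    have h2 := congr_fun h1 u₀
    simp at h2
  have hWtop : W ≠ ⊤ := by
    intro htop
    obtain ⟨u₁, hu₁⟩ : ∃ u₁, lev u₁ ≠ lev u₀ := by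
      by_cases h1 : lev u = lev u₀
      · exact ⟨u', fun h2 => hne (h1.trans h2.symm)⟩
      · exact ⟨u, h1⟩
    have hmem : Q *ᵥ Pi.single u₁ 1 ∈ W := by rw [htop]; exact Submodule.mem_top
    obtain ⟨y, hy, hyQ⟩ := Submodule.mem_map.mp hmem
    have hyeq : y = Pi.single u₁ 1 := by
      have h1 := congr_arg (fun v => P *ᵥ v) hyQ
      simpa only [Matrix.mulVecLin_apply, Matrix.mulVec_mulVec, hPQ, Matrix.one_mulVec] using h1
    have h2 := (hW₀ y).1 hy u₁ hu₁
    rw [hyeq] at h2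
    simp at h2
  rcases hirr W hWinv with h | h
  · exact hWbot h
  · exact hWtop h

/-- Conjugation commutes with powers (`P·Q = 1`). -/
theorem conj_pow (P M Q : Matrix n n ℂ) (hPQ : P * Q = 1) (p : ℕ) : (P * M * Q) ^ p = P * M ^ p * Q := by
  have hQP : Q * P = 1 := mul_eq_one_comm.mp hPQ
  induction p with
  | zero => simp [hPQ]
  | succ p ih =>
    rw [pow_succ, ih, pow_succ]
    calc P * M ^ p * Q * (P * M * Q) = P * M ^ p * (Q * P) * M * Q := by simp only [Matrix.mul_assoc]
      _ = P * (M ^ p * M) * Q := by rw [hQP, Matrix.mul_one]; simp only [Matrix.mul_assoc]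

end Bridge

/-! ## Transport along an index bijection (to state everything over `Fin d`) -/

section Transport

variable {m n : Type} [Fintype m] [DecidableEq m] [Fintype n] [DecidableEq n]

/-- Membership in the reindexed space. -/
theorem mem_reindexSpace (e : m ≃ n) (L : Submodule ℂ (Matrix m m ℂ)) (M' : Matrix n n ℂ) :
    M' ∈ L.map (Matrix.reindexAlgEquiv ℂ ℂ e).toLinearEquiv.toLinearMap ↔ ∃ M ∈ L, Matrix.reindexAlgEquiv ℂ ℂ e M = M' := by
  simp only [Submodule.mem_map]
  rfl

/-- A reindexed matrix acts by conjugating the action with the index bijection. -/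
theorem reindexAlgEquiv_mulVec (e : m ≃ n) (M : Matrix m m ℂ) (v : n → ℂ) :
    Matrix.reindexAlgEquiv ℂ ℂ e M *ᵥ v = (M *ᵥ (v ∘ e)) ∘ e.symm := by
  have h : Matrix.reindexAlgEquiv ℂ ℂ e M = Matrix.reindex e e M := congrFun (Matrix.coe_reindexAlgEquiv ℂ ℂ e) M
  rw [h, Matrix.reindex_apply, Matrix.submatrix_mulVec_equiv, Equiv.symm_symm]

/-- Reindexing preserves «all members nilpotent». -/
theorem reindexSpace_nilpotent (e : m ≃ n) (L : Submodule ℂ (Matrix m m ℂ)) (h : ∀ M ∈ L, IsNilpotent M) :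
    ∀ M' ∈ L.map (Matrix.reindexAlgEquiv ℂ ℂ e).toLinearEquiv.toLinearMap, IsNilpotent M' := by
  intro M' hM'
  obtain ⟨M, hM, rfl⟩ := (mem_reindexSpace e L M').1 hM'
  obtain ⟨p, hp⟩ := h M hM
  exact ⟨p, by rw [← map_pow, hp, map_zero]⟩

/-- Reindexing preserves a uniform nil-index bound. -/
theorem reindexSpace_pow_eq_zero (e : m ≃ n) (L : Submodule ℂ (Matrix m m ℂ)) (r : ℕ)
    (h : ∀ M ∈ L, M ^ r = 0) : ∀ M' ∈ L.map (Matrix.reindexAlgEquiv ℂ ℂ e).toLinearEquiv.toLinearMap, M' ^ r = 0 := by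
  intro M' hM'
  obtain ⟨M, hM, rfl⟩ := (mem_reindexSpace e L M').1 hM'
  rw [← map_pow, h M hM, map_zero]

/-- Reindexing preserves «some member has `M^r ≠ 0`». -/
theorem reindexSpace_pow_ne_zero (e : m ≃ n) (L : Submodule ℂ (Matrix m m ℂ)) (r : ℕ)
    (h : ∃ M ∈ L, M ^ r ≠ 0) : ∃ M' ∈ L.map (Matrix.reindexAlgEquiv ℂ ℂ e).toLinearEquiv.toLinearMap, M' ^ r ≠ 0 := by
  obtain ⟨M, hM, hr⟩ := h
  refine ⟨Matrix.reindexAlgEquiv ℂ ℂ e M, (mem_reindexSpace e L _).2 ⟨M, hM, rfl⟩, ?_⟩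
  rw [← map_pow]
  exact (map_ne_zero_iff _ (Matrix.reindexAlgEquiv ℂ ℂ e).injective).2 hr

/-- Reindexing preserves the dimension of the space. -/
theorem finrank_reindexSpace (e : m ≃ n) (L : Submodule ℂ (Matrix m m ℂ)) :
    Module.finrank ℂ (L.map (Matrix.reindexAlgEquiv ℂ ℂ e).toLinearEquiv.toLinearMap) = Module.finrank ℂ L :=
  LinearEquiv.finrank_map_eq _ _

/-- Reindexing preserves irreducibility. -/
theorem reindexSpace_irreducible (e : m ≃ n) (L : Submodule ℂ (Matrix m m ℂ))
    (h : ∀ W : Submodule ℂ (m → ℂ), (∀ M ∈ L, ∀ x ∈ W, M *ᵥ x ∈ W) → W = ⊥ ∨ W = ⊤) :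
    ∀ W' : Submodule ℂ (n → ℂ), (∀ M' ∈ L.map (Matrix.reindexAlgEquiv ℂ ℂ e).toLinearEquiv.toLinearMap, ∀ x ∈ W', M' *ᵥ x ∈ W') → W' = ⊥ ∨ W' = ⊤ := by
  intro W' hW'
  let φ : (m → ℂ) ≃ₗ[ℂ] (n → ℂ) := LinearEquiv.funCongrLeft ℂ ℂ e.symm
  have hφ : ∀ v : m → ℂ, φ v = v ∘ e.symm := fun v => rfl
  let W : Submodule ℂ (m → ℂ) := W'.comap φ.toLinearMap
  have hW : ∀ M ∈ L, ∀ x ∈ W, M *ᵥ x ∈ W := by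
    intro M hM x hx
    have h1 := hW' (Matrix.reindexAlgEquiv ℂ ℂ e M) ((mem_reindexSpace e L _).2 ⟨M, hM, rfl⟩) (φ x) hx
    have h2 : Matrix.reindexAlgEquiv ℂ ℂ e M *ᵥ φ x = φ (M *ᵥ x) := by
      rw [hφ, hφ, reindexAlgEquiv_mulVec]
      have : (x ∘ ⇑e.symm) ∘ ⇑e = x := by ext i; simp
      rw [this]
    rw [h2] at h1
    exact h1
  rcases h W hW with hb | ht
  · left
    rw [eq_bot_iff]
    intro y hy
    have h1 : φ.symm y ∈ W := by
      show φ (φ.symm y) ∈ W'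
      rw [LinearEquiv.apply_symm_apply]
      exact hy
    rw [hb, Submodule.mem_bot] at h1
    rw [Submodule.mem_bot, ← φ.apply_symm_apply y, h1, map_zero]
  · right
    rw [eq_top_iff]
    intro y _
    have h1 : φ.symm y ∈ W := by rw [ht]; exact Submodule.mem_top
    have h2 : φ (φ.symm y) ∈ W' := h1
    rwa [LinearEquiv.apply_symm_apply] at h2

end Transport

/-! ## The `Fin (3k)`-indexed copy `L′_k ⊂ M_{3k}(ℂ)` and its five properties -/

/-- `|(Fin k ⊕ Fin k) ⊕ Fin k| = 3k`. -/
theorem card_ι (k : ℕ) : Fintype.card (ι k) = 3 * k := by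
  simp only [ι, Fintype.card_sum, Fintype.card_fin]
  ring

/-- **`L′_k` as a space of `3k × 3k` matrices** (`k ≥ 1`): transport of `L k` along an index bijection
`(Fin k ⊕ Fin k) ⊕ Fin k ≃ Fin (3k)`; the five properties — nilpotent members, irreducible, an element with `N^{2k} ≠ 0`,
every member has `N^{2k+1} = 0`, dimension `≥ k²`. -/
theorem exists_Lfin (k : ℕ) (hk : 1 ≤ k) : ∃ L' : Submodule ℂ (Matrix (Fin (3 * k)) (Fin (3 * k)) ℂ),
    (∀ M ∈ L', IsNilpotent M) ∧
    (∀ W : Submodule ℂ (Fin (3 * k) → ℂ), (∀ M ∈ L', ∀ w ∈ W, M.mulVec w ∈ W) → W = ⊥ ∨ W = ⊤) ∧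
    (∃ M ∈ L', M ^ (2 * k) ≠ 0) ∧
    (∀ M ∈ L', M ^ (2 * k + 1) = 0) ∧
    k ^ 2 ≤ Module.finrank ℂ L' := by
  obtain ⟨e⟩ : Nonempty (ι k ≃ Fin (3 * k)) := ⟨Fintype.equivFinOfCardEq (card_ι k)⟩
  refine ⟨(L k).map (Matrix.reindexAlgEquiv ℂ ℂ e).toLinearEquiv.toLinearMap,
    reindexSpace_nilpotent e _ (L_nilpotent k), reindexSpace_irreducible e _ (L_irreducible k),
    reindexSpace_pow_ne_zero e _ _ (L_pow_ne_zero k hk), reindexSpace_pow_eq_zero e _ _ (fun M hM => ?_),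
    (finrank_reindexSpace e (L k)).symm ▸ sq_le_finrank_L k⟩
  obtain ⟨A, c, t, rfl⟩ := (mem_L_iff k M).1 hM
  exact N_pow_eq_zero k A c t

/-! ## The negative theorems -/

/-- **Irreducible spaces of nilpotent matrices have unbounded nil-index** (contrast: MOR 1991 §5's examples have
index `3`, and `span{S, R}` has index `d` but dimension `2`). -/
theorem exists_irreducible_nilpotent_space_pow_ne_zero (r : ℕ) :
    ∃ (d : ℕ) (L : Submodule ℂ (Matrix (Fin d) (Fin d) ℂ)),
      (∀ M ∈ L, IsNilpotent M) ∧
      (∀ W : Submodule ℂ (Fin d → ℂ), (∀ M ∈ L, ∀ w ∈ W, M.mulVec w ∈ W) → W = ⊥ ∨ W = ⊤) ∧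
      (r + 1) ^ 2 ≤ Module.finrank ℂ L ∧ ∃ M ∈ L, M ^ r ≠ 0 := by
  obtain ⟨L', hnil, hirr, ⟨M, hM, hMpow⟩, -, hdim⟩ := exists_Lfin (r + 1) (by omega)
  refine ⟨3 * (r + 1), L', hnil, hirr, hdim, M, hM, fun h => hMpow ?_⟩
  rw [show 2 * (r + 1) = r + (r + 2) by ring, pow_add, h, Matrix.zero_mul]

/-- **`¬ ThinWild`.**  The body below is, verbatim, `…Cruxes.DualUnipotentThreeHalves.ThinWild.ThinWild` (statement T2 of
the line `thin_wild` of crux `GrenetZeon.DualUnipotentThreeHalves`): «`dim L · r ≤ C·d²` for every irreducible space `L`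
of nilpotent `d × d` matrices with an element of nil-index `> r`».  Witness against `C`: `L′_k`, `k = 5C + 1`, `d = 3k`,
`r = 2k`: `dim L · r ≥ 2k³ > 9C·k² = C·d²`. -/
theorem thinWild_false : ¬ (∃ C : ℕ, ∀ (d r : ℕ) (L : Submodule ℂ (Matrix (Fin d) (Fin d) ℂ)),
    (∀ N ∈ L, IsNilpotent N) →
    (∀ W : Submodule ℂ (Fin d → ℂ), (∀ N ∈ L, ∀ w ∈ W, N.mulVec w ∈ W) → W = ⊥ ∨ W = ⊤) →
    (∃ N ∈ L, N ^ r ≠ 0) → Module.finrank ℂ L * r ≤ C * d ^ 2) := by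
  rintro ⟨C, hC⟩
  obtain ⟨L', hnil, hirr, hne, -, hdim⟩ := exists_Lfin (5 * C + 1) (by omega)
  have h := hC (3 * (5 * C + 1)) (2 * (5 * C + 1)) L' hnil hirr hne
  have h1 : (5 * C + 1) ^ 2 * (2 * (5 * C + 1)) ≤ (5 * C + 1) ^ 2 * (9 * C) := by
    rw [show (5 * C + 1) ^ 2 * (9 * C) = C * (3 * (5 * C + 1)) ^ 2 by ring]
    exact le_trans (Nat.mul_le_mul_right _ hdim) h
  have h2 := Nat.le_of_mul_le_mul_left h1 (by positivity)
  omega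

/-- **`¬ ThinWildFat`.**  The body is, verbatim, `…Cruxes.DualUnipotentThreeHalves.ThinWild.ThinWildFat` (T2♭, «the EXACT
per-agnostic load of the line»): the same inequality asked only of fat spaces, `d⁴ ≤ (dim L)³`.  Witness against `C`:
`L′_k`, `k = 5C + 9` (fat: `d⁴ = 81k⁴ ≤ k⁶ ≤ (dim L)³` as `k ≥ 9`). -/
theorem thinWildFat_false : ¬ (∃ C : ℕ, ∀ (d r : ℕ) (L : Submodule ℂ (Matrix (Fin d) (Fin d) ℂ)),
    (∀ N ∈ L, IsNilpotent N) →
    (∀ W : Submodule ℂ (Fin d → ℂ), (∀ N ∈ L, ∀ w ∈ W, N.mulVec w ∈ W) → W = ⊥ ∨ W = ⊤) →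
    (∃ N ∈ L, N ^ r ≠ 0) → d ^ 4 ≤ Module.finrank ℂ L ^ 3 → Module.finrank ℂ L * r ≤ C * d ^ 2) := by
  rintro ⟨C, hC⟩
  obtain ⟨L', hnil, hirr, hne, -, hdim⟩ := exists_Lfin (5 * C + 9) (by omega)
  have hfat : (3 * (5 * C + 9)) ^ 4 ≤ Module.finrank ℂ L' ^ 3 := by
    calc (3 * (5 * C + 9)) ^ 4 = 81 * (5 * C + 9) ^ 4 := by ring
      _ ≤ (5 * C + 9) ^ 2 * (5 * C + 9) ^ 4 :=
          Nat.mul_le_mul_right _ (le_trans (by norm_num) (Nat.pow_le_pow_left (show 9 ≤ 5 * C + 9 by omega) 2))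
      _ = ((5 * C + 9) ^ 2) ^ 3 := by ring
      _ ≤ Module.finrank ℂ L' ^ 3 := Nat.pow_le_pow_left hdim 3
  have h := hC (3 * (5 * C + 9)) (2 * (5 * C + 9)) L' hnil hirr hne hfat
  have h1 : (5 * C + 9) ^ 2 * (2 * (5 * C + 9)) ≤ (5 * C + 9) ^ 2 * (9 * C) := by
    rw [show (5 * C + 9) ^ 2 * (9 * C) = C * (3 * (5 * C + 9)) ^ 2 by ring]
    exact le_trans (Nat.mul_le_mul_right _ hdim) h
  have h2 := Nat.le_of_mul_le_mul_left h1 (by positivity)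
  omega

/-- **Cheap index mass is not reachable by conjugation** (portrait of stub U2 `WildUnfold.CheapIndexMass` of the line
`wild_portrait`, at the level of matrix spaces).  For every `C` there is an irreducible space `L ⊂ M_d(ℂ)` of nilpotent
matrices (`d = 3(C+1)`, `L = L′_{C+1}`) such that EVERY conjugate block form of `L` — one change of basis `M ↦ P·M·Q`,
`P·Q = 1`, block-upper-triangular for a level function `lev`, with the level-`l` diagonal blocks nilpotent of index
`≤ r l` — has index mass `Σ_u r(lev u) > C·d`.  (By the bridge lemma the block form has ONE level, whose block is the whole
matrix, of nil-index `2k+1 > C`.)  Hence the `C·m` index mass that U2 asks of SOME representation of `per_n` cannot be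
obtained from a given representation by conjugation alone: re-representation (or the permanent) is load-bearing. -/
theorem no_cheap_indexMass_by_conjugation (C : ℕ) :
    ∃ (d : ℕ) (L : Submodule ℂ (Matrix (Fin d) (Fin d) ℂ)), 0 < d ∧ (∀ M ∈ L, IsNilpotent M) ∧
      (∀ W : Submodule ℂ (Fin d → ℂ), (∀ M ∈ L, ∀ w ∈ W, M.mulVec w ∈ W) → W = ⊥ ∨ W = ⊤) ∧
      ∀ (P Q : Matrix (Fin d) (Fin d) ℂ) (lev : Fin d → ℕ) (r : ℕ → ℕ), P * Q = 1 →
        (∀ M ∈ L, ∀ i j, lev j < lev i → (P * M * Q) i j = 0) →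
        (∀ M ∈ L, ∀ l : ℕ, (Matrix.of fun i j => if lev i = l ∧ lev j = l then (P * M * Q) i j else 0) ^ r l = 0) →
        C * d < ∑ u, r (lev u) := by
  obtain ⟨L', hnil, hirr, ⟨M₀, hM₀, hM₀pow⟩, -, -⟩ := exists_Lfin (C + 1) (by omega)
  refine ⟨3 * (C + 1), L', by omega, hnil, hirr, ?_⟩
  intro P Q lev r hPQ hup hdiag
  have hconst := level_const_of_irreducible L' hirr P Q hPQ lev hup
  let u₀ : Fin (3 * (C + 1)) := ⟨0, by omega⟩
  have hblk : (Matrix.of fun i j => if lev i = lev u₀ ∧ lev j = lev u₀ then (P * M₀ * Q) i j else 0) =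
      P * M₀ * Q := by
    ext i j
    simp [hconst i u₀, hconst j u₀]
  have hpow : (P * M₀ * Q) ^ r (lev u₀) = 0 := by rw [← hblk]; exact hdiag M₀ hM₀ (lev u₀)
  rw [conj_pow P M₀ Q hPQ] at hpow
  have hQP : Q * P = 1 := mul_eq_one_comm.mp hPQ
  have hM₀r : M₀ ^ r (lev u₀) = 0 := by
    calc M₀ ^ r (lev u₀) = (Q * P) * M₀ ^ r (lev u₀) * (Q * P) := by rw [hQP, Matrix.one_mul, Matrix.mul_one]
      _ = Q * (P * M₀ ^ r (lev u₀) * Q) * P := by simp only [Matrix.mul_assoc]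
      _ = 0 := by rw [hpow, Matrix.mul_zero, Matrix.zero_mul]
  have hr : 2 * (C + 1) + 1 ≤ r (lev u₀) := by
    by_contra hlt
    have hlt' := Nat.lt_of_not_le hlt
    apply hM₀pow
    rw [show 2 * (C + 1) = r (lev u₀) + (2 * (C + 1) - r (lev u₀)) by omega, pow_add, hM₀r, Matrix.zero_mul]
  have hsum : ∑ u, r (lev u) = 3 * (C + 1) * r (lev u₀) := by
    rw [Finset.sum_congr rfl (fun u _ => by rw [hconst u u₀]), Finset.sum_const, Finset.card_univ,
      Fintype.card_fin, smul_eq_mul]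
  rw [hsum]
  nlinarith

end Summit.ValiantsHypothesis.ValiantsHypothesis.Theorems.DualUnipotentThreeHalvesNegative.ThinWild
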